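import Summits.Ventures.PercRepro.C026SuperAdd

/-!
# The mixed slacks of C-026: pivotal events, their disjointness, and the bilinear identity (p6, gen 15)

Fix an edge `e`.  Every event `X` has two **lifts** `lift e s X = {ω | ω[e := s] ∈ X}` (`s = true`: `e`
forced open, `s = false`: forced closed), insensitive to the state of `e`, and the law with `e` forced
is the law of the lift: `P_{p[e:=1]}(X) = P_p(lift e true X)`, `P_{p[e:=0]}(X) = P_p(lift e false X)`
(`prob_update_one_eq_prob_lift`, `prob_update_zero_eq_prob_lift`).  The **pivotal event**
`pivEvent e X = lift e true X ∖ lift e false X` is where `e` decides `X`; for the C-026 events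
`B = {c ↔ a} ∪ {c ↔ b}` and `A = {a ↔ b}` the tree's pivotal differences are its probabilities
(`pivD26_eq_prob_pivEvent`, `pivA26_eq_prob_pivEvent`), and the two pivotal events are DISJOINT
(`pivEvent_disjoint`, MINE3-SUPERADD §3 (a), from the contraction lemma `conn_update_true_iff`):
`I_D + I_A ≤ 1` and `I_D · I_A ≤ ¼`.

The **mixed slacks** `f_ij = 2·P(B_i ∩ A_jᶜ) − P(B_i)·P(A_jᶜ)` (`B_i`, `A_j` the lifts, `i, j ∈ {0, 1}`;
`f_00 = f(p[e:=0])`, `f_11 = f(p[e:=1])`) satisfy the exact identity of the note §8 (a)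
(`mixedSlack_sum_eq`): `f_01 + f_10 = f_00 + f_11 − I_D · I_A`, so that

* SA at `e` (`Mix26`) is `0 ≤ f_01 + f_10` (`Mix26_iff_mixed`), ROW C-036 «SA¼» at `e` is
  `¾ (f_00 + f_11) ≤ f_01 + f_10` (`SAQuarter26_iff_mixed`), and in general
  `SAConst26 κ ↔ (1 − κ)(f_00 + f_11) ≤ f_01 + f_10` (`SAConst26_iff_mixed`);
* the C-026 slack is BILINEAR in the state of `e` (`slack26_eq_bilinear`):
  `f(p) = (1 − p_e)² f_00 + p_e² f_11 + p_e (1 − p_e) (f_01 + f_10)`.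

Nothing here proves SA: these are exact reformulations of what the row asserts at one edge.
-/

namespace PercRepro

open Finset

/-! ### Lifts: an event seen with one edge forced -/

section Lift

variable {E : Type*} [Fintype E] [DecidableEq E]

/-- `X` seen with the edge `e` forced to the state `s`: `{ω | ω[e := s] ∈ X}`. -/
def lift (e : E) (s : Bool) (X : Set (Config E)) : Set (Config E) :=
  (fun ω : Config E => Function.update ω e s) ⁻¹' X

omit [Fintype E] in
/-- Membership in a lift. -/
theorem mem_lift {e : E} {s : Bool} {X : Set (Config E)} {ω : Config E} :
    ω ∈ lift e s X ↔ Function.update ω e s ∈ X := Iff.rfl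

omit [Fintype E] in
/-- A lift is insensitive to the state of `e`. -/
theorem flipEdge_mem_lift_iff (e : E) (s : Bool) (X : Set (Config E)) (ω : Config E) :
    flipEdge e ω ∈ lift e s X ↔ ω ∈ lift e s X := by
  simp only [mem_lift, flipEdge, Function.update_idem]

omit [Fintype E] in
/-- The lift of an intersection. -/
theorem lift_inter (e : E) (s : Bool) (X Y : Set (Config E)) :
    lift e s (X ∩ Y) = lift e s X ∩ lift e s Y := rfl

omit [Fintype E] in
/-- The lift of a complement. -/
theorem lift_compl (e : E) (s : Bool) (X : Set (Config E)) :
    lift e s Xᶜ = (lift e s X)ᶜ := rfl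

omit [Fintype E] in
/-- Forcing `e` closed is below forcing it open. -/
theorem config_update_false_le_true (ω : Config E) (e : E) :
    Function.update ω e false ≤ Function.update ω e true := by
  intro e'
  by_cases h : e' = e
  · subst h
    simp
  · rw [Function.update_of_ne h, Function.update_of_ne h]

omit [Fintype E] in
/-- For an increasing event the closed lift is contained in the open lift. -/
theorem lift_false_subset_lift_true {e : E} {X : Set (Config E)} (hX : IsUpperSet X) :
    lift e false X ⊆ lift e true X :=
  fun ω hω => hX (config_update_false_le_true ω e) hω

/-- For an `e`-insensitive event, forcing `e` closed or open gives the same probability (the flip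
of `e` is a weight-preserving bijection between the two slices). -/
theorem prob_update_zero_eq_prob_update_one (p : E → ℝ) (e : E) {Z : Set (Config E)}
    (hZ : ∀ ω, flipEdge e ω ∈ Z ↔ ω ∈ Z) :
    prob (Function.update p e 0) Z = prob (Function.update p e 1) Z := by
  unfold prob
  simp only [indicator_weight_update_zero, indicator_weight_update_one]
  rw [← (flipEdge_involutive e).bijective.sum_comp]
  refine Finset.sum_congr rfl fun ω _ => ?_
  rw [← Set.indicator_comp_right (flipEdge e)]
  have hcomp : weightErase p e ∘ flipEdge e = weightErase p e := funext (weightErase_flipEdge p e)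
  have hset : flipEdge e ⁻¹' (Z ∩ {ω | ω e = false}) = Z ∩ {ω | ω e = true} := by
    ext ω'
    simp only [Set.mem_preimage, Set.mem_inter_iff, Set.mem_setOf_eq, hZ, flipEdge_apply_self]
    cases ω' e <;> simp
  rw [hcomp, hset]

/-- Under `p[e := 1]` the open lift of `X` is `X`. -/
theorem prob_update_one_lift (p : E → ℝ) (e : E) (X : Set (Config E)) :
    prob (Function.update p e 1) (lift e true X) = prob (Function.update p e 1) X := by
  rw [← prob_update_one_inter_open p e (lift e true X), ← prob_update_one_inter_open p e X]
  congr 1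
  ext ω
  simp only [Set.mem_inter_iff, mem_lift, Set.mem_setOf_eq]
  constructor
  · rintro ⟨h1, h2⟩
    rw [Function.update_eq_self_iff.2 h2.symm] at h1
    exact ⟨h1, h2⟩
  · rintro ⟨h1, h2⟩
    rw [Function.update_eq_self_iff.2 h2.symm]
    exact ⟨h1, h2⟩

/-- Under `p[e := 0]` the closed lift of `X` is `X`. -/
theorem prob_update_zero_lift (p : E → ℝ) (e : E) (X : Set (Config E)) :
    prob (Function.update p e 0) (lift e false X) = prob (Function.update p e 0) X := by
  rw [← prob_update_zero_inter_closed p e (lift e false X), ← prob_update_zero_inter_closed p e X]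
  congr 1
  ext ω
  simp only [Set.mem_inter_iff, mem_lift, Set.mem_setOf_eq]
  constructor
  · rintro ⟨h1, h2⟩
    rw [Function.update_eq_self_iff.2 h2.symm] at h1
    exact ⟨h1, h2⟩
  · rintro ⟨h1, h2⟩
    rw [Function.update_eq_self_iff.2 h2.symm]
    exact ⟨h1, h2⟩

/-- **The law with `e` forced open is the law of the open lift**: `P_{p[e:=1]}(X) = P_p(lift e true X)`. -/
theorem prob_update_one_eq_prob_lift (p : E → ℝ) (e : E) (X : Set (Config E)) :
    prob (Function.update p e 1) X = prob p (lift e true X) := by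
  rw [prob_split p e (lift e true X), prob_update_one_lift,
    prob_update_zero_eq_prob_update_one p e (flipEdge_mem_lift_iff e true X), prob_update_one_lift]
  ring

/-- **The law with `e` forced closed is the law of the closed lift**:
`P_{p[e:=0]}(X) = P_p(lift e false X)`. -/
theorem prob_update_zero_eq_prob_lift (p : E → ℝ) (e : E) (X : Set (Config E)) :
    prob (Function.update p e 0) X = prob p (lift e false X) := by
  rw [prob_split p e (lift e false X),
    ← prob_update_zero_eq_prob_update_one p e (flipEdge_mem_lift_iff e false X),
    prob_update_zero_lift]
  ring

/-! ### Pivotal events -/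

/-- **The pivotal event** of `e` for `X`: `X` holds with `e` open and fails with `e` closed. -/
def pivEvent (e : E) (X : Set (Config E)) : Set (Config E) :=
  lift e true X ∩ (lift e false X)ᶜ

omit [Fintype E] in
/-- Membership in the pivotal event. -/
theorem mem_pivEvent {e : E} {X : Set (Config E)} {ω : Config E} :
    ω ∈ pivEvent e X ↔ Function.update ω e true ∈ X ∧ Function.update ω e false ∉ X := Iff.rfl

/-- For an increasing event, `P(lift open) − P(lift closed) = P(pivotal)`. -/
theorem prob_lift_true_sub_lift_false (p : E → ℝ) (e : E) {X : Set (Config E)}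
    (hX : IsUpperSet X) :
    prob p (lift e true X) - prob p (lift e false X) = prob p (pivEvent e X) := by
  have h := prob_diff p (lift e true X) (lift e false X)
  rw [Set.inter_eq_right.2 (lift_false_subset_lift_true hX)] at h
  rw [pivEvent, ← Set.sdiff_eq, h]

/-- Splitting `S ∩ Tᶜ` along a larger `U ⊇ T`: `P(S ∩ Tᶜ) = P(S ∩ Uᶜ) + P(S ∩ (U ∩ Tᶜ))`. -/
theorem prob_inter_compl_of_subset (p : E → ℝ) {S T U : Set (Config E)} (hTU : T ⊆ U) :
    prob p (S ∩ Tᶜ) = prob p (S ∩ Uᶜ) + prob p (S ∩ (U ∩ Tᶜ)) := by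
  rw [← prob_union_of_disjoint]
  · congr 1
    ext ω
    simp only [Set.mem_inter_iff, Set.mem_compl_iff, Set.mem_union]
    constructor
    · rintro ⟨hS, hT⟩
      by_cases hU : ω ∈ U
      · exact Or.inr ⟨hS, hU, hT⟩
      · exact Or.inl ⟨hS, hU⟩
    · rintro (⟨hS, hU⟩ | ⟨hS, _, hT⟩)
      · exact ⟨hS, fun hT => hU (hTU hT)⟩
      · exact ⟨hS, hT⟩
  · rw [Set.disjoint_left]
    rintro ω ⟨_, hU⟩ ⟨_, hU', _⟩
    exact hU hU'

/-- Splitting `U ∩ S` along a smaller `T ⊆ U`: `P(U ∩ S) = P(T ∩ S) + P((U ∩ Tᶜ) ∩ S)`. -/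
theorem prob_inter_of_subset (p : E → ℝ) {S T U : Set (Config E)} (hTU : T ⊆ U) :
    prob p (U ∩ S) = prob p (T ∩ S) + prob p ((U ∩ Tᶜ) ∩ S) := by
  rw [← prob_union_of_disjoint]
  · congr 1
    ext ω
    simp only [Set.mem_inter_iff, Set.mem_compl_iff, Set.mem_union]
    constructor
    · rintro ⟨hU, hS⟩
      by_cases hT : ω ∈ T
      · exact Or.inl ⟨hT, hS⟩
      · exact Or.inr ⟨⟨hU, hT⟩, hS⟩
    · rintro (⟨hT, hS⟩ | ⟨⟨hU, _⟩, hS⟩)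
      · exact ⟨hTU hT, hS⟩
      · exact ⟨hU, hS⟩
  · rw [Set.disjoint_left]
    rintro ω ⟨hT, _⟩ ⟨⟨_, hT'⟩, _⟩
    exact hT' hT

end Lift

namespace MultiGraph

variable {V E : Type*} (G : MultiGraph V E) [Fintype E] [DecidableEq E]

/-! ### The two pivotal differences as probabilities; their disjointness -/

/-- `I_A` is the probability that `e` is pivotal for `A = {a ↔ b}`. -/
theorem pivA26_eq_prob_pivEvent (p : E → ℝ) (e : E) (a b c : V) :
    G.pivA26 p e a b c = prob p (pivEvent e (G.connEvent a b)) := by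
  rw [pivA26_eq, prob_update_one_eq_prob_lift, prob_update_zero_eq_prob_lift,
    prob_lift_true_sub_lift_false p e (G.isUpperSet_connEvent a b)]

/-- `I_D` is the probability that `e` is pivotal for `B = {c ↔ a} ∪ {c ↔ b}`. -/
theorem pivD26_eq_prob_pivEvent (p : E → ℝ) (e : E) (a b c : V) :
    G.pivD26 p e a b c = prob p (pivEvent e (G.connEvent c a ∪ G.connEvent c b)) := by
  rw [pivD26_eq_rowsB, G.law3_zero_add_two_add_three, G.law3_zero_add_two_add_three,
    prob_update_one_eq_prob_lift, prob_update_zero_eq_prob_lift,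
    prob_lift_true_sub_lift_false p e
      ((G.isUpperSet_connEvent c a).union (G.isUpperSet_connEvent c b))]

omit [Fintype E] in
/-- **Disjointness** (MINE3-SUPERADD §3 (a)): `e` cannot be pivotal for `B = {c ↔ {a, b}}` and for
`A = {a ↔ b}` at the same configuration — if opening `e = xy` joins `a` to `b`, then `a` and `b` sit at
its two ends, and `c`, sitting at one end, already reaches a mark. -/
theorem pivEvent_disjoint (e : E) (a b c : V) :
    Disjoint (pivEvent e (G.connEvent c a ∪ G.connEvent c b)) (pivEvent e (G.connEvent a b)) := by
  rw [Set.disjoint_left]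
  rintro ω ⟨hB1, hB0⟩ ⟨hA1, hA0⟩
  have h1 : Function.update ω e true = Function.update (Function.update ω e false) e true := by
    rw [Function.update_idem]
  simp only [mem_lift, Set.mem_compl_iff, Set.mem_union, mem_connEvent] at hB1 hB0 hA1 hA0
  rw [h1] at hB1 hA1
  rw [conn_update_true_iff] at hA1
  have hcxy : G.Conn (Function.update ω e false) c (G.fst e) ∨
      G.Conn (Function.update ω e false) c (G.snd e) := by
    rcases hB1 with h | h <;> rw [conn_update_true_iff] at h <;>
      rcases h with h | ⟨h1, _⟩ | ⟨h1, _⟩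
    · exact absurd (Or.inl h) hB0
    · exact Or.inl h1
    · exact Or.inr h1
    · exact absurd (Or.inr h) hB0
    · exact Or.inl h1
    · exact Or.inr h1
  apply hB0
  rcases hA1 with h | ⟨hax, hyb⟩ | ⟨hay, hxb⟩
  · exact absurd h hA0
  · rcases hcxy with hcx | hcy
    · exact Or.inl (hcx.trans hax.symm)
    · exact Or.inr (hcy.trans hyb)
  · rcases hcxy with hcx | hcy
    · exact Or.inr (hcx.trans hxb)
    · exact Or.inl (hcy.trans hay.symm)

/-- `I_D + I_A ≤ 1`. -/
theorem pivD26_add_pivA26_le_one {p : E → ℝ} (hp : IsProb p) (e : E) (a b c : V) :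
    G.pivD26 p e a b c + G.pivA26 p e a b c ≤ 1 := by
  rw [pivD26_eq_prob_pivEvent, pivA26_eq_prob_pivEvent,
    ← prob_union_of_disjoint p (G.pivEvent_disjoint e a b c)]
  exact prob_le_one hp _

/-- `I_D · I_A ≤ ¼`: the pivotal product never exceeds a quarter. -/
theorem pivD26_mul_pivA26_le_quarter {p : E → ℝ} (hp : IsProb p) (e : E) (a b c : V) :
    G.pivD26 p e a b c * G.pivA26 p e a b c ≤ 1 / 4 := by
  have h := G.pivD26_add_pivA26_le_one hp e a b c
  have hD := G.pivD26_nonneg hp e a b c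
  have hA := G.pivA26_nonneg hp e a b c
  nlinarith [sq_nonneg (G.pivD26 p e a b c - G.pivA26 p e a b c)]

/-! ### The mixed slacks -/

/-- **The mixed slack** `f_ij = 2·P(B_i ∩ A_jᶜ) − P(B_i)·P(A_jᶜ)`, `B_i`/`A_j` the lifts of
`B = {c ↔ a} ∪ {c ↔ b}` / `A = {a ↔ b}` with `e` forced to `i` / `j` (`false` = closed = `H − e`,
`true` = open = `H / e`). -/
noncomputable def mixedSlack (p : E → ℝ) (e : E) (i j : Bool) (a b c : V) : ℝ :=
  2 * prob p (lift e i (G.connEvent c a ∪ G.connEvent c b) ∩ (lift e j (G.connEvent a b))ᶜ) -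
    prob p (lift e i (G.connEvent c a ∪ G.connEvent c b)) * prob p ((lift e j (G.connEvent a b))ᶜ)

/-- The C-026 slack as probabilities: `f = 2·P(B ∩ Aᶜ) − P(B)·P(Aᶜ)`. -/
theorem slack26_eq_prob (p : E → ℝ) (a b c : V) :
    G.slack26 p a b c =
      2 * prob p ((G.connEvent c a ∪ G.connEvent c b) ∩ G.sepEvent a b) -
        prob p (G.connEvent c a ∪ G.connEvent c b) * prob p (G.sepEvent a b) := by
  rw [G.slack26_eq_two_mul_slackGamma_half, G.slackGamma_eq_prob]
  ring

/-- `f(p[e:=0]) = f_00`. -/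
theorem slack26_update_zero_eq_mixedSlack (p : E → ℝ) (e : E) (a b c : V) :
    G.slack26 (Function.update p e 0) a b c = G.mixedSlack p e false false a b c := by
  rw [slack26_eq_prob, prob_update_zero_eq_prob_lift, prob_update_zero_eq_prob_lift,
    prob_update_zero_eq_prob_lift]
  rfl

/-- `f(p[e:=1]) = f_11`. -/
theorem slack26_update_one_eq_mixedSlack (p : E → ℝ) (e : E) (a b c : V) :
    G.slack26 (Function.update p e 1) a b c = G.mixedSlack p e true true a b c := by
  rw [slack26_eq_prob, prob_update_one_eq_prob_lift, prob_update_one_eq_prob_lift,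
    prob_update_one_eq_prob_lift]
  rfl

/-- The cross terms agree: `P(B_0 ∩ A_0ᶜ) + P(B_1 ∩ A_1ᶜ) = P(B_0 ∩ A_1ᶜ) + P(B_1 ∩ A_0ᶜ)` — the
difference is `P(Piv_B ∩ Piv_A) = 0`. -/
theorem prob_mixed_cross (p : E → ℝ) (e : E) (a b c : V) :
    prob p (lift e false (G.connEvent c a ∪ G.connEvent c b) ∩ (lift e false (G.connEvent a b))ᶜ) +
        prob p (lift e true (G.connEvent c a ∪ G.connEvent c b) ∩ (lift e true (G.connEvent a b))ᶜ) =
      prob p (lift e false (G.connEvent c a ∪ G.connEvent c b) ∩ (lift e true (G.connEvent a b))ᶜ) +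
        prob p (lift e true (G.connEvent c a ∪ G.connEvent c b) ∩ (lift e false (G.connEvent a b))ᶜ) := by
  have hA := lift_false_subset_lift_true (e := e) (G.isUpperSet_connEvent a b)
  have hB := lift_false_subset_lift_true (e := e)
    ((G.isUpperSet_connEvent c a).union (G.isUpperSet_connEvent c b))
  have h0 := prob_inter_compl_of_subset p (S := lift e false (G.connEvent c a ∪ G.connEvent c b)) hA
  have h1 := prob_inter_compl_of_subset p (S := lift e true (G.connEvent c a ∪ G.connEvent c b)) hA
  have hsplit := prob_inter_of_subset p
    (S := lift e true (G.connEvent a b) ∩ (lift e false (G.connEvent a b))ᶜ) hB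
  have hzero : prob p ((lift e true (G.connEvent c a ∪ G.connEvent c b) ∩
      (lift e false (G.connEvent c a ∪ G.connEvent c b))ᶜ) ∩
      (lift e true (G.connEvent a b) ∩ (lift e false (G.connEvent a b))ᶜ)) = 0 := by
    have hd := Set.disjoint_iff_inter_eq_empty.1 (G.pivEvent_disjoint e a b c)
    unfold pivEvent at hd
    rw [hd, prob_empty]
  rw [hzero] at hsplit
  linarith

/-- **The identity of the mixed slacks** (MINE3-SUPERADD §8 (a)): `f_01 + f_10 = f_00 + f_11 − I_D · I_A`. -/
theorem mixedSlack_sum_eq (p : E → ℝ) (e : E) (a b c : V) :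
    G.mixedSlack p e false true a b c + G.mixedSlack p e true false a b c =
      G.mixedSlack p e false false a b c + G.mixedSlack p e true true a b c -
        G.pivD26 p e a b c * G.pivA26 p e a b c := by
  have hc := G.prob_mixed_cross p e a b c
  have hD : G.pivD26 p e a b c = prob p (lift e true (G.connEvent c a ∪ G.connEvent c b)) -
      prob p (lift e false (G.connEvent c a ∪ G.connEvent c b)) := by
    rw [pivD26_eq_rowsB, G.law3_zero_add_two_add_three, G.law3_zero_add_two_add_three,
      prob_update_one_eq_prob_lift, prob_update_zero_eq_prob_lift]
  have hA : G.pivA26 p e a b c = prob p ((lift e false (G.connEvent a b))ᶜ) -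
      prob p ((lift e true (G.connEvent a b))ᶜ) := by
    rw [pivA26_eq_rowsAc, G.law3_two_add_three_add_four, G.law3_two_add_three_add_four,
      prob_update_one_eq_prob_lift, prob_update_zero_eq_prob_lift]
    rfl
  rw [hD, hA]
  unfold mixedSlack
  linear_combination (-2) * hc

/-- **SA at `e` is the nonnegativity of the two mixed slacks**: `(Mix)_e ↔ 0 ≤ f_01 + f_10`. -/
theorem Mix26_iff_mixed (p : E → ℝ) (e : E) (a b c : V) :
    G.Mix26 p e a b c ↔
      0 ≤ G.mixedSlack p e false true a b c + G.mixedSlack p e true false a b c := by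
  rw [G.mixedSlack_sum_eq, Mix26, slack26_update_zero_eq_mixedSlack,
    slack26_update_one_eq_mixedSlack]
  constructor <;> intro h <;> linarith

/-- **SA with the constant `κ` at `e` in the mixed slacks**:
`SAConst26 κ ↔ (1 − κ)(f_00 + f_11) ≤ f_01 + f_10`. -/
theorem SAConst26_iff_mixed (κ : ℝ) (p : E → ℝ) (e : E) (a b c : V) :
    G.SAConst26 κ p e a b c ↔
      (1 - κ) * (G.mixedSlack p e false false a b c + G.mixedSlack p e true true a b c) ≤
        G.mixedSlack p e false true a b c + G.mixedSlack p e true false a b c := by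
  rw [G.mixedSlack_sum_eq, SAConst26, slack26_update_zero_eq_mixedSlack,
    slack26_update_one_eq_mixedSlack]
  constructor <;> intro h <;> linarith

/-- **ROW C-036 «SA¼» at `e` in the mixed slacks**: `¾ (f_00 + f_11) ≤ f_01 + f_10`. -/
theorem SAQuarter26_iff_mixed (p : E → ℝ) (e : E) (a b c : V) :
    G.SAQuarter26 p e a b c ↔
      (3 / 4) * (G.mixedSlack p e false false a b c + G.mixedSlack p e true true a b c) ≤
        G.mixedSlack p e false true a b c + G.mixedSlack p e true false a b c := by
  rw [SAQuarter26, G.SAConst26_iff_mixed]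
  norm_num

/-- **The bilinear identity** (MINE3-SUPERADD §8 (a)): the C-026 slack at `p` is bilinear in the
state of `e`, `f(p) = (1 − p_e)² f_00 + p_e² f_11 + p_e (1 − p_e) (f_01 + f_10)`. -/
theorem slack26_eq_bilinear (p : E → ℝ) (e : E) (a b c : V) :
    G.slack26 p a b c =
      (1 - p e) ^ 2 * G.mixedSlack p e false false a b c +
        p e ^ 2 * G.mixedSlack p e true true a b c +
        p e * (1 - p e) * (G.mixedSlack p e false true a b c + G.mixedSlack p e true false a b c) := by
  rw [G.mixedSlack_sum_eq, G.c026_rec p e a b c, slack26_update_zero_eq_mixedSlack,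
    slack26_update_one_eq_mixedSlack]
  ring

end MultiGraph

end PercRepro
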